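import Literature.Topology.FourManifolds.BandSumModel
import Literature.Topology.FourManifolds.BandSumNormalTransport
import Literature.Topology.FourManifolds.BandSumCommProofs
import Literature.Topology.FourManifolds.BandSumConcordanceCore
import Literature.Topology.FourManifolds.ConcordanceStraighteningBoth
import HarnessLib

/-!
# Concordance of connected sums: the one-sided fact, proved

Topic `Literature/Topology/FourManifolds`; the assembly of the decomposition of the Fox–Milnor
congruence `Literature.Topology.FourManifolds.Knot.IsConnectedSum.isConcordant`
(`BandSum.lean`; Fox–Milnor (1966), §1: the knot cobordism classes form an abelian group under
`#`; Livingston (2005), Thm. 2.2). This file proves the remaining named fact of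
`BandSumConcordanceCore.lean`:

* **`Knot.exists_isConnectedSum_isConcordant_left_holds`** — if `K₁ ~ K₁'` are concordant then
  for every knot `K₂` some connected sum `K₁ # K₂` is concordant to some connected sum
  `K₁' # K₂`. *Proof* (Fox–Milnor's carrying construction, assembled from the tree): straighten
  the concordance to a conical one (`IsConcordance.exists_conical`), take a good tube along the
  arc `θ = 0` (`IsConicalConcordance.exists_goodTube`), replace `K₂` by an isotopic knot `Kn`
  with a flat arc (`Knot.exists_flatArc_param`), choose the height `a` of the band so that the
  point `x₀ = a e₁` of the tube is read by the chart `ψ` at both ends (`exists_height`), an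
  orientation-compatible isometric frame (`exists_frameOf_det_pos`), a scale `l` below the
  bounds of `exists_ambientIsotopy_comp_affine` at both ends and of the model
  (`BandSumModel.lean`), and a collar width `δ`; the model (`ModelData`) gives the detour
  (`KnotPiece.detour`), whose new end knots `newKnot₁`, `newKnot₂` are concordant
  (`isConcordance_newAnnulus`) and are band sums inside the two end frames
  (`KnotPiece.InTube.bandData`), hence connected sums `K₁ # Kn`, `K₁' # Kn`
  (`KnotPiece.InTube.isConnectedSum_of_transport`), i.e. `K₁ # K₂`, `K₁' # K₂`.
* `Knot.exists_isConnectedSum_isConcordant_right_holds`, `Knot.exists_isConnectedSum_isConcordant_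
  of_schubert`, **`Knot.IsConnectedSum.isConcordant_of_schubert`** — the second-factor version,
  the connected sum of concordances and the full congruence, granted only Schubert's uniqueness of
  the connected sum (`Knot.IsConnectedSum.isIsotopic`, the named fact of `BandSum.lean` whose
  decomposition is `ConnectedSumNormalForm.lean`/`SchubertNormalForm.lean`).

## References

* R. H. Fox, J. W. Milnor, *Singularities of 2-spheres in 4-space and cobordism of knots*, Osaka
  J. Math. 3 (1966), 257–267, §1. [FoxMilnor1966]
* C. Livingston, *A survey of classical knot concordance*, Handbook of Knot Theory (2005), §2.1,
  Thm. 2.2 (held: arXiv math/0307077, p. 3). [Livingston2005]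

## Design notes

No statement of another file is modified; no named facts, no `sorry`. `𝔼 n`, `𝕊 n` are local
notation as in `Knots.lean`.
-/

open Set Function Metric
open scoped Topology ContDiff Manifold RealInnerProductSpace

noncomputable section

namespace Literature.Topology.FourManifolds

/-- Local notation: `𝔼 n` is the model Euclidean space `EuclideanSpace ℝ (Fin n)`. -/
local notation "𝔼 " n:arg => EuclideanSpace ℝ (Fin n)
/-- Local notation for the unit sphere `𝕊 n ⊆ 𝔼 (n+1)`. -/
local notation "𝕊 " n:arg => Metric.sphere (0 : EuclideanSpace ℝ (Fin (n + 1))) 1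

namespace Knot.IsConicalConcordance

open KnotsInBall StripFrame BandFoliation ChartData KnotPiece AffineIsotopy

variable {K K' : Knot} {f : (𝕊 1) × ℝ → 𝔼 4} {δ : ℝ} (h : IsConicalConcordance K K' f δ) {w : 𝔼 4}
  {η ε : ℝ}

/-! ### The two end frames of a good tube -/

/-- **The lower end frame** of a good tube. [folklore] -/
def endFrame₁ (G : (h.setup w).GoodTube 0 η ε) : EndFrame η ε where
  c := h.c₁ w
  contDiff_c := h.contDiff_c₁ w
  norm_c := h.norm_c₁ w
  injOn_c := h.injOn_c₁ G
  injective_fderiv_c := fun _ hx ↦ h.injective_fderiv_c₁ G hx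

/-- **The upper end frame** of a good tube. [folklore] -/
def endFrame₂ (G : (h.setup w).GoodTube 0 η ε) : EndFrame η ε where
  c := h.c₂ w
  contDiff_c := h.contDiff_c₂ w
  norm_c := h.norm_c₂ w
  injOn_c := h.injOn_c₂ G
  injective_fderiv_c := fun _ hx ↦ h.injective_fderiv_c₂ G hx

/-- The lower end frame as a map to the sphere is `cS₁`. [folklore] -/
theorem endFrame₁_cS (G : (h.setup w).GoodTube 0 η ε) (x : 𝔼 3) : (h.endFrame₁ G).cS x = h.cS₁ w x :=
  Subtype.ext rfl

/-- The upper end frame as a map to the sphere is `cS₂`. [folklore] -/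
theorem endFrame₂_cS (G : (h.setup w).GoodTube 0 η ε) (x : 𝔼 3) : (h.endFrame₂ G).cS x = h.cS₂ w x :=
  Subtype.ext rfl

/-- The lower end frame's chart is `c₁`. [folklore] -/
@[simp] theorem endFrame₁_c (G : (h.setup w).GoodTube 0 η ε) : (h.endFrame₁ G).c = h.c₁ w := rfl

/-- The upper end frame's chart is `c₂`. [folklore] -/
@[simp] theorem endFrame₂_c (G : (h.setup w).GoodTube 0 η ε) : (h.endFrame₂ G).c = h.c₂ w := rfl

/-- `mpt t` of a point in coordinates. [folklore] -/
theorem mpt_eq (t : ℝ) (x : 𝔼 3) : mpt t x = ((x 0, t), (x 1, x 2)) := rfl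

/-- **The end knot `K` is the lower frame image of the core.** [folklore] -/
theorem coe_K_circlePt (u : ℝ) : ((K (circlePt u) : 𝕊 3) : 𝔼 4) = h.c₁ w (core u) := by
  rw [c₁, mpt_eq, core_apply_zero, core_apply_one]
  have h2 : core u 2 = 0 := by simp [core]
  rw [h2, show (((0 : ℝ), (0 : ℝ)) : ℝ × ℝ) = 0 from rfl, (h.setup w).tube_zero (u, 1), setup_F,
    annulusLift_apply, h.isConcordance.2.2.2.2.2.1]

/-- **The end knot `K'` is the upper frame image of the core.** [folklore] -/
theorem coe_K'_circlePt (u : ℝ) : ((K' (circlePt u) : 𝕊 3) : 𝔼 4) = h.c₂ w (core u) := by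
  rw [c₂, mpt_eq, core_apply_zero, core_apply_one]
  have h2 : core u 2 = 0 := by simp [core]
  rw [h2, show (((0 : ℝ), (0 : ℝ)) : ℝ × ℝ) = 0 from rfl, (h.setup w).tube_zero (u, 2), setup_F,
    annulusLift_apply, h.isConcordance.2.2.2.2.2.2, smul_smul]
  norm_num

/-- **Separation at the lower end**: a point of the lower frame over the core strip on the knot
`K` is a core point with the same parameter. [folklore] -/
theorem separated₁ (G : (h.setup w).GoodTube 0 η ε) (x : 𝔼 3) (hx : x 0 ∈ Icc (-(η / 4)) (η / 4))
    (hd : ((x 1, x 2) : ℝ × ℝ) ∈ ball (0 : ℝ × ℝ) ε) (u : ℝ)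
    (he : h.c₁ w x = ((K (circlePt u) : 𝕊 3) : 𝔼 4)) : x 1 = 0 ∧ x 2 = 0 ∧ ∃ m : ℤ, u = x 0 + m := by
  have hK : ((K (circlePt u) : 𝕊 3) : 𝔼 4) = (h.setup w).F (u, 1) := by
    rw [setup_F, annulusLift_apply, h.isConcordance.2.2.2.2.2.1]
  rw [hK, c₁, mpt_eq] at he
  obtain ⟨hd0, -, m, hm⟩ := G.separated (x 0, 1) (mk_mem_prod (by simpa using hx) ⟨le_rfl, by norm_num⟩)
    (x 1, x 2) hd u 1 ⟨le_rfl, by norm_num⟩ he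
  simp only [Prod.mk_eq_zero] at hd0
  exact ⟨hd0.1, hd0.2, m, hm⟩

/-- **Separation at the upper end.** [folklore] -/
theorem separated₂ (G : (h.setup w).GoodTube 0 η ε) (x : 𝔼 3) (hx : x 0 ∈ Icc (-(η / 4)) (η / 4))
    (hd : ((x 1, x 2) : ℝ × ℝ) ∈ ball (0 : ℝ × ℝ) ε) (u : ℝ)
    (he : h.c₂ w x = ((K' (circlePt u) : 𝕊 3) : 𝔼 4)) : x 1 = 0 ∧ x 2 = 0 ∧ ∃ m : ℤ, u = x 0 + m := by
  have hK : (2 : ℝ) • ((K' (circlePt u) : 𝕊 3) : 𝔼 4) = (h.setup w).F (u, 2) := by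
    rw [setup_F, annulusLift_apply, h.isConcordance.2.2.2.2.2.2]
  have he' : (h.setup w).tube ((x 0, 2), (x 1, x 2)) = (h.setup w).F (u, 2) := by
    rw [← hK, ← he, c₂, mpt_eq, smul_smul]; norm_num
  obtain ⟨hd0, -, m, hm⟩ := G.separated (x 0, 2) (mk_mem_prod (by simpa using hx) ⟨by norm_num, le_rfl⟩)
    (x 1, x 2) hd u 2 ⟨by norm_num, le_rfl⟩ he'
  simp only [Prod.mk_eq_zero] at hd0
  exact ⟨hd0.1, hd0.2, m, hm⟩

/-! ### A height at which both ends are read by the chart `ψ` -/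

/-- **Choice of the band height.** Some `a ∈ [ε/6, ε/4]` has `x₀ = a e₁` in both chart domains
`W₁`, `W₂` (each end chart is injective on the region, so at most one height is sent to the south
pole by each). [folklore] -/
theorem exists_height (G : (h.setup w).GoodTube 0 η ε) :
    ∃ a ∈ Icc (ε / 6) (ε / 4), (a • e3 1 : 𝔼 3) ∈ h.W₁ w ∧ (a • e3 1 : 𝔼 3) ∈ h.W₂ w := by
  have hε := G.ε_pos
  have hη := G.η_pos
  have hreg : ∀ a ∈ Icc (ε / 6) (ε / 4), (a • e3 1 : 𝔼 3) ∈ region 0 η ε := by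
    intro a ha
    refine ⟨by simp [hη], ?_⟩
    simp only [PiLp.smul_apply, e3_apply, smul_eq_mul]
    simp
    rw [abs_of_pos (by linarith [ha.1])]
    linarith [ha.2]
  -- at most one bad height for each end
  have uniq₁ : ∀ a ∈ Icc (ε / 6) (ε / 4), ∀ b ∈ Icc (ε / 6) (ε / 4),
      (a • e3 1 : 𝔼 3) ∉ h.W₁ w → (b • e3 1 : 𝔼 3) ∉ h.W₁ w → a = b := by
    intro a ha b hb hna hnb
    simp only [W₁, mem_setOf_eq, not_not] at hna hnb
    have := h.injOn_c₁ G (hreg a ha) (hreg b hb) (by rw [← coe_cS₁, ← coe_cS₁, hna, hnb])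
    simpa using congrArg (fun v : 𝔼 3 ↦ v 1) this
  have uniq₂ : ∀ a ∈ Icc (ε / 6) (ε / 4), ∀ b ∈ Icc (ε / 6) (ε / 4),
      (a • e3 1 : 𝔼 3) ∉ h.W₂ w → (b • e3 1 : 𝔼 3) ∉ h.W₂ w → a = b := by
    intro a ha b hb hna hnb
    simp only [W₂, mem_setOf_eq, not_not] at hna hnb
    have := h.injOn_c₂ G (hreg a ha) (hreg b hb) (by rw [← coe_cS₂, ← coe_cS₂, hna, hnb])
    simpa using congrArg (fun v : 𝔼 3 ↦ v 1) this
  -- three candidates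
  have m4 : ε / 4 ∈ Icc (ε / 6) (ε / 4) := ⟨by linarith, le_rfl⟩
  have m5 : ε / 5 ∈ Icc (ε / 6) (ε / 4) := ⟨by linarith, by linarith⟩
  have m6 : ε / 6 ∈ Icc (ε / 6) (ε / 4) := ⟨le_rfl, by linarith⟩
  have n45 : ε / 4 ≠ ε / 5 := by intro h'; linarith
  have n46 : ε / 4 ≠ ε / 6 := by intro h'; linarith
  have n56 : ε / 5 ≠ ε / 6 := by intro h'; linarith
  by_cases h4₁ : ((ε / 4) • e3 1 : 𝔼 3) ∈ h.W₁ w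
  · by_cases h4₂ : ((ε / 4) • e3 1 : 𝔼 3) ∈ h.W₂ w
    · exact ⟨ε / 4, m4, h4₁, h4₂⟩
    -- `ε/4` is the bad height of end 2; `ε/5`, `ε/6` are good for end 2, one of them for end 1
    have h5₂ : ((ε / 5) • e3 1 : 𝔼 3) ∈ h.W₂ w := by
      by_contra hn; exact n45 (uniq₂ _ m4 _ m5 h4₂ hn)
    have h6₂ : ((ε / 6) • e3 1 : 𝔼 3) ∈ h.W₂ w := by
      by_contra hn; exact n46 (uniq₂ _ m4 _ m6 h4₂ hn)
    by_cases h5₁ : ((ε / 5) • e3 1 : 𝔼 3) ∈ h.W₁ w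
    · exact ⟨ε / 5, m5, h5₁, h5₂⟩
    · have h6₁ : ((ε / 6) • e3 1 : 𝔼 3) ∈ h.W₁ w := by
        by_contra hn; exact n56 (uniq₁ _ m5 _ m6 h5₁ hn)
      exact ⟨ε / 6, m6, h6₁, h6₂⟩
  · have h5₁ : ((ε / 5) • e3 1 : 𝔼 3) ∈ h.W₁ w := by
      by_contra hn; exact n45 (uniq₁ _ m4 _ m5 h4₁ hn)
    have h6₁ : ((ε / 6) • e3 1 : 𝔼 3) ∈ h.W₁ w := by
      by_contra hn; exact n46 (uniq₁ _ m4 _ m6 h4₁ hn)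
    by_cases h5₂ : ((ε / 5) • e3 1 : 𝔼 3) ∈ h.W₂ w
    · exact ⟨ε / 5, m5, h5₁, h5₂⟩
    · have h6₂ : ((ε / 6) • e3 1 : 𝔼 3) ∈ h.W₂ w := by
        by_contra hn; exact n56 (uniq₂ _ m5 _ m6 h5₂ hn)
      exact ⟨ε / 6, m6, h6₁, h6₂⟩

/-! ### The carrying construction, for a given model -/

/-- **The carrying construction for a given model.** Let `G` be a good tube along `θ = 0` of a
conical concordance from `K` to `K'`, `md` a model (`ModelData`) fitting the tube (`η ≤ 1`,
`lℓ ≤ η/8`, `8lρ' ≤ η`, `2a < ε`),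
and `F₁`, `F₂` compactly supported ambient isotopies of `ℝ³` ending, on the model ball
`B̄(0, ρ')`, in `g₁ ∘ T` resp. `g₂ ∘ T` (`exists_ambientIsotopy_comp_affine`), with `T` mapping
that ball into both chart domains. Then the new end knots of the detour of the model are
connected sums `K # Kn`, `K' # Kn` and are concordant. [cite: FoxMilnor1966, §1] -/
theorem exists_isConnectedSum_isConcordant_of_model (G : (h.setup w).GoodTube 0 η ε) (md : ModelData)
    (hη1 : η ≤ 1) (hℓη : md.l * md.ℓ ≤ η / 8)
    (hρη : 8 * md.l * md.ρ' ≤ η) (haε : 2 * md.a < ε)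
    (F₁ F₂ : AmbientIsotopy 𝓘(ℝ, 𝔼 3) (𝔼 3))
    (hF₁ : ∀ z ∈ closedBall (0 : 𝔼 3) md.ρ', F₁.toFun 1 z = h.g₁ w (md.T z)) {R₁ : ℝ}
    (hR₁ : ∀ t (y : 𝔼 3), R₁ ≤ ‖y‖ → F₁.toFun t y = y)
    (hF₂ : ∀ z ∈ closedBall (0 : 𝔼 3) md.ρ', F₂.toFun 1 z = h.g₂ w (md.T z)) {R₂ : ℝ}
    (hR₂ : ∀ t (y : 𝔼 3), R₂ ≤ ‖y‖ → F₂.toFun t y = y)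
    (hTW : ∀ z ∈ closedBall (0 : 𝔼 3) md.ρ', md.T z ∈ h.W₁ w ∩ h.W₂ w) :
    ∃ L L' : Knot, IsConnectedSum K md.Kn L ∧ IsConnectedSum K' md.Kn L' ∧ L.IsConcordant L' := by
  have hρ' := md.ρ'_pos
  -- the tube fit and the detour
  have hfit : md.piece.TubeFit η ε := md.tubeFit hη1 hℓη hρη haε
  set Dt := KnotPiece.detour hfit with hDt
  -- `T` maps the chart image of `Kn` into the region
  have hT : ∀ y, affT md.x₀ md.p md.M md.l (psi (md.Kn y)) ∈ region 0 η ε := fun y ↦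
    (md.T_mem hρη haε (ball_subset_closedBall (md.psi_mem_ball y))).2.2.2
  -- the knots
  set tiny₁ := h.tinyKnot₁ (w := w) G md.hKn md.l_pos.ne' hT with htiny₁
  set tiny₂ := h.tinyKnot₂ (w := w) G md.hKn md.l_pos.ne' hT with htiny₂
  set N₁ := h.newKnot₁ Dt G with hN₁
  set N₂ := h.newKnot₂ Dt G with hN₂
  -- the two band-sum configurations
  have in₁ : md.piece.InTube (h.endFrame₁ G) K tiny₁ N₁ :=
    { fit := hfit
      lo3 := md.lo3 hℓη
      hi3 := md.hi3 hℓη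
      hKend := fun u ↦ h.coe_K_circlePt u
      htiny := fun θ ↦ by
        rw [htiny₁, h.coe_tinyKnot₁, endFrame₁_c, ModelData.piece_k, ModelData.k_apply]; rfl
      hKnew := fun u ↦ by
        rw [hN₁, circlePt_eq_circlePoint, h.coe_newKnot₁_circlePoint, mul_div_cancel_left₀ _ (by positivity),
          endFrame₁_c]
        rfl
      separated := fun x hx hd u he' ↦ h.separated₁ G x hx hd u he'
      clean := md.clean }
  have in₂ : md.piece.InTube (h.endFrame₂ G) K' tiny₂ N₂ :=
    { fit := hfit
      lo3 := md.lo3 hℓη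
      hi3 := md.hi3 hℓη
      hKend := fun u ↦ h.coe_K'_circlePt u
      htiny := fun θ ↦ by
        rw [htiny₂, h.coe_tinyKnot₂, endFrame₂_c, ModelData.piece_k, ModelData.k_apply]; rfl
      hKnew := fun u ↦ by
        rw [hN₂, circlePt_eq_circlePoint, h.coe_newKnot₂_circlePoint, mul_div_cancel_left₀ _ (by positivity),
          endFrame₂_c]
        rfl
      separated := fun x hx hd u he' ↦ h.separated₂ G x hx hd u he'
      clean := md.clean }
  -- the transported isotopies on `𝕊³`
  set Θ₁ := F₁.alongChart (φ := psi) contMDiffOn_psi contMDiff_psi_symm psi_target hR₁ with hΘ₁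
  set Θ₂ := F₂.alongChart (φ := psi) contMDiffOn_psi contMDiff_psi_symm psi_target hR₂ with hΘ₂
  have hΘ₁' : ∀ z ∈ closedBall (0 : 𝔼 3) md.ρ', Θ₁.toFun 1 (psi.symm z) = (h.endFrame₁ G).cS (md.T z) := by
    intro z hz
    rw [hΘ₁, AmbientIsotopy.alongChart_toFun, chartTransport_of_mem _ (mem_psi_source (psi_symm_ne_southPole z)),
      psi_apply_psi_symm, hF₁ z hz, endFrame₁_cS]
    exact psi_symm_apply_psi (hTW z hz).1
  have hΘ₂' : ∀ z ∈ closedBall (0 : 𝔼 3) md.ρ', Θ₂.toFun 1 (psi.symm z) = (h.endFrame₂ G).cS (md.T z) := by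
    intro z hz
    rw [hΘ₂, AmbientIsotopy.alongChart_toFun, chartTransport_of_mem _ (mem_psi_source (psi_symm_ne_southPole z)),
      psi_apply_psi_symm, hF₂ z hz, endFrame₂_cS]
    exact psi_symm_apply_psi (hTW z hz).2
  have hTmaps : MapsTo md.T (closedBall (0 : 𝔼 3) md.ρ') (region 0 η ε) := fun z hz ↦
    (md.T_mem hρη haε hz).2.2.2
  -- the connected sums
  have hsum₁ : IsConnectedSum K md.Kn N₁ := by
    refine in₁.isConnectedSum_of_transport md.hKn md.T hρ' Θ₁ hΘ₁' hTmaps (fun y ↦ ?_) md.psi_mem_ball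
      (fun y z hz heq ↦ ?_) (fun x hx ↦ md.B_mem_image_iff hx)
    · apply Subtype.ext; rw [htiny₁, h.coe_tinyKnot₁, endFrame₁_cS, coe_cS₁]; rfl
    · obtain ⟨v, -, rfl⟩ := InTube.exists_window (C := md.chart) y
      obtain ⟨h0, hd, hpos, -⟩ := md.T_mem hρη haε hz
      have := (in₁.separated (md.T z) h0 hd v (by rw [heq]; rfl)).1
      linarith
  have hsum₂ : IsConnectedSum K' md.Kn N₂ := by
    refine in₂.isConnectedSum_of_transport md.hKn md.T hρ' Θ₂ hΘ₂' hTmaps (fun y ↦ ?_) md.psi_mem_ball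
      (fun y z hz heq ↦ ?_) (fun x hx ↦ md.B_mem_image_iff hx)
    · apply Subtype.ext; rw [htiny₂, h.coe_tinyKnot₂, endFrame₂_cS, coe_cS₂]; rfl
    · obtain ⟨v, -, rfl⟩ := InTube.exists_window (C := md.chart) y
      obtain ⟨h0, hd, hpos, -⟩ := md.T_mem hρη haε hz
      have := (in₂.separated (md.T z) h0 hd v (by rw [heq]; rfl)).1
      linarith
  exact ⟨N₁, N₂, hsum₁, hsum₂, ⟨_, h.isConcordance_newAnnulus Dt G⟩⟩

/-! ### The carrying construction -/

/-- **Fox–Milnor's carrying construction.** Given a conical concordance from `K` to `K'` with a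
good tube along the arc `θ = 0` and any knot `K₂`, there are connected sums `K # K₂` and `K' # K₂`
and a concordance between them: replace `K₂` by an isotopic knot with a flat arc, choose the
height, the frame, the scale and the collar width, build the model and apply
`exists_isConnectedSum_isConcordant_of_model`. [cite: FoxMilnor1966, §1] -/
theorem exists_isConnectedSum_isConcordant (G : (h.setup w).GoodTube 0 η ε) (K₂ : Knot) :
    ∃ L L' : Knot, IsConnectedSum K K₂ L ∧ IsConnectedSum K' K₂ L' ∧ L.IsConcordant L' := by
  have hε := G.ε_pos
  have hη := G.η_pos
  have hη4 := G.η_le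
  -- the flat arc of the second summand
  obtain ⟨Kn, hK₂Kn, hKn, p, e, ℓ, ν, he, he2, hℓ, hν, hlow, hbox, α, θ₁, β, σ, hαθ, hθβ, hβ, hσ, hσ',
    -, hσα, hσβ, hseg⟩ := K₂.exists_flatArc_param
  -- a bound of the second summand in the chart
  obtain ⟨Rb, hRb⟩ : ∃ Rb : ℝ, ∀ y, ‖psi (Kn y)‖ ≤ Rb := by
    obtain ⟨R, hR⟩ := (isCompact_range (Knot.contMDiff_psi_comp hKn).continuous).isBounded.exists_norm_le
    exact ⟨R, fun y ↦ hR _ ⟨y, rfl⟩⟩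
  have hRb0 : 0 ≤ Rb := le_trans (norm_nonneg _) (hRb (circlePoint 0))
  have hρ'pos : 0 < Rb + 1 := by linarith
  -- the height of the band
  obtain ⟨a, ha, hx₁, hx₂⟩ := h.exists_height G
  have ha0 : 0 < a := by linarith [ha.1]
  have hx₀reg : (a • e3 1 : 𝔼 3) ∈ region 0 η ε := by
    refine ⟨by simp [hη], ?_⟩
    simp only [PiLp.smul_apply, e3_apply, smul_eq_mul]
    simp
    rw [abs_of_pos ha0]; linarith [ha.2]
  -- the frame, oriented compatibly with the lower end chart
  obtain ⟨s, hs, hdet⟩ := exists_frameOf_det_pos (equivOfInjective _ (h.injective_fderiv_g₁ G hx₀reg hx₁)) he he2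
  rw [coe_equivOfInjective] at hdet
  -- the two linearised transports on the model ball
  have hWo : IsOpen (region 0 η ε ∩ (h.W₁ w ∩ h.W₂ w)) :=
    (isOpen_region 0 η ε).inter ((h.isOpen_W₁ w).inter (h.isOpen_W₂ w))
  have hxW : (a • e3 1 : 𝔼 3) ∈ region 0 η ε ∩ (h.W₁ w ∩ h.W₂ w) := ⟨hx₀reg, hx₁, hx₂⟩
  have hg₁ : ContDiffOn ℝ ∞ (h.g₁ w) (region 0 η ε ∩ (h.W₁ w ∩ h.W₂ w)) :=
    (h.contDiffOn_g₁ w).mono fun x hx ↦ hx.2.1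
  have hg₂ : ContDiffOn ℝ ∞ (h.g₂ w) (region 0 η ε ∩ (h.W₁ w ∩ h.W₂ w)) :=
    (h.contDiffOn_g₂ w).mono fun x hx ↦ hx.2.2
  have hL₁' : HasFDerivAt (h.g₁ w)
      (equivOfInjective _ (h.injective_fderiv_g₁ G hx₀reg hx₁) : 𝔼 3 →L[ℝ] 𝔼 3) (a • e3 1) := by
    rw [coe_equivOfInjective]; exact (h.differentiableAt_g₁ hx₁).hasFDerivAt
  have hL₂' : HasFDerivAt (h.g₂ w)
      (equivOfInjective _ (h.injective_fderiv_g₂ G hx₀reg hx₂) : 𝔼 3 →L[ℝ] 𝔼 3) (a • e3 1) := by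
    rw [coe_equivOfInjective]; exact (h.differentiableAt_g₂ hx₂).hasFDerivAt
  have hM₁ : 0 < (toMat ((equivOfInjective _ (h.injective_fderiv_g₁ G hx₀reg hx₁) : 𝔼 3 →L[ℝ] 𝔼 3).comp
      (frameOf he he2 hs : 𝔼 3 →L[ℝ] 𝔼 3))).det := by
    rw [coe_equivOfInjective]; exact hdet
  have hM₂ : 0 < (toMat ((equivOfInjective _ (h.injective_fderiv_g₂ G hx₀reg hx₂) : 𝔼 3 →L[ℝ] 𝔼 3).comp
      (frameOf he he2 hs : 𝔼 3 →L[ℝ] 𝔼 3))).det := by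
    rw [coe_equivOfInjective]; exact h.det_toMat_comp_pos G hx₀reg hx₁ hx₂ _ hdet
  have hZc : IsCompact (closedBall (0 : 𝔼 3) (Rb + 1)) := isCompact_closedBall _ _
  obtain ⟨l₁, hl₁, H₁⟩ := exists_ambientIsotopy_comp_affine hWo hg₁ hxW _ _ hL₁' hM₁ hZc p
  obtain ⟨l₂, hl₂, H₂⟩ := exists_ambientIsotopy_comp_affine hWo hg₂ hxW _ _ hL₂' hM₂ hZc p
  -- the scale
  obtain ⟨l, hlpos, hll₁, hll₂, hl_a, hl_η, hl_ℓ⟩ : ∃ l : ℝ, 0 < l ∧ l < l₁ ∧ l < l₂ ∧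
      16 * l * (Rb + 1) ≤ a ∧ 8 * l * (Rb + 1) ≤ η ∧ l * ℓ ≤ η / 8 := by
    refine ⟨min (min l₁ l₂ / 2) (min (a / (16 * (Rb + 1))) (min (η / (8 * (Rb + 1))) (η / (8 * ℓ)))),
      lt_min (by positivity) (lt_min (by positivity) (lt_min (by positivity) (by positivity))), ?_, ?_, ?_, ?_, ?_⟩
    · have h1 : min (min l₁ l₂ / 2) (min (a / (16 * (Rb + 1))) (min (η / (8 * (Rb + 1))) (η / (8 * ℓ)))) ≤
        min l₁ l₂ / 2 := min_le_left _ _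
      have := min_le_left l₁ l₂; linarith
    · have h1 : min (min l₁ l₂ / 2) (min (a / (16 * (Rb + 1))) (min (η / (8 * (Rb + 1))) (η / (8 * ℓ)))) ≤
        min l₁ l₂ / 2 := min_le_left _ _
      have := min_le_right l₁ l₂; linarith
    · have h1 : min (min l₁ l₂ / 2) (min (a / (16 * (Rb + 1))) (min (η / (8 * (Rb + 1))) (η / (8 * ℓ)))) ≤
        a / (16 * (Rb + 1)) := (min_le_right _ _).trans (min_le_left _ _)
      rw [le_div_iff₀ (by positivity)] at h1; linarith
    · have h1 : min (min l₁ l₂ / 2) (min (a / (16 * (Rb + 1))) (min (η / (8 * (Rb + 1))) (η / (8 * ℓ)))) ≤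
        η / (8 * (Rb + 1)) := ((min_le_right _ _).trans (min_le_right _ _)).trans (min_le_left _ _)
      rw [le_div_iff₀ (by positivity)] at h1; linarith
    · have h1 : min (min l₁ l₂ / 2) (min (a / (16 * (Rb + 1))) (min (η / (8 * (Rb + 1))) (η / (8 * ℓ)))) ≤
        η / (8 * ℓ) := ((min_le_right _ _).trans (min_le_right _ _)).trans (min_le_right _ _)
      rw [le_div_iff₀ (by positivity)] at h1; linarith
  obtain ⟨hTW, F₁, hF₁, R₁, hR₁⟩ := H₁ l ⟨hlpos, hll₁⟩
  obtain ⟨-, F₂, hF₂, R₂, hR₂⟩ := H₂ l ⟨hlpos, hll₂⟩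
  -- the collar width
  obtain ⟨δ', hδ'pos, hδ'le, hδ'room, hδ'up, hδ'clean⟩ : ∃ δ' : ℝ, 0 < δ' ∧ δ' ≤ 1 / 8 ∧
      δ' * (16 * a * (Rb + 1)) ≤ l ∧ δ' * (16 * (Rb + 1) ^ 2) < 1 ∧ δ' * (2 * a) ≤ l * ν := by
    refine ⟨min (1 / 8) (min (l / (16 * a * (Rb + 1))) (min (1 / (32 * (Rb + 1) ^ 2)) (l * ν / (2 * a)))),
      lt_min (by norm_num) (lt_min (by positivity) (lt_min (by positivity) (by positivity))), min_le_left _ _,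
      ?_, ?_, ?_⟩
    · have h1 : min (1 / 8) (min (l / (16 * a * (Rb + 1))) (min (1 / (32 * (Rb + 1) ^ 2)) (l * ν / (2 * a)))) ≤
        l / (16 * a * (Rb + 1)) := (min_le_right _ _).trans (min_le_left _ _)
      rwa [le_div_iff₀ (by positivity)] at h1
    · have h1 : min (1 / 8) (min (l / (16 * a * (Rb + 1))) (min (1 / (32 * (Rb + 1) ^ 2)) (l * ν / (2 * a)))) ≤
        1 / (32 * (Rb + 1) ^ 2) := ((min_le_right _ _).trans (min_le_right _ _)).trans (min_le_left _ _)
      rw [le_div_iff₀ (by positivity)] at h1; nlinarith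
    · have h1 : min (1 / 8) (min (l / (16 * a * (Rb + 1))) (min (1 / (32 * (Rb + 1) ^ 2)) (l * ν / (2 * a)))) ≤
        l * ν / (2 * a) := ((min_le_right _ _).trans (min_le_right _ _)).trans (min_le_right _ _)
      rwa [le_div_iff₀ (by positivity)] at h1
  -- the model
  let md : ModelData :=
    { Kn := Kn, hKn := hKn, p := p, e := e, ℓ := ℓ, ν := ν, α := α, β := β, σ := σ, norm_e := he,
      e_two := he2, ℓ_pos := hℓ, ν_pos := hν, lowest := hlow, box := hbox, α_lt_β := hαθ.trans hθβ,
      β_lt := hβ, contDiff_σ := hσ, deriv_σ_pos := hσ', σ_α := hσα, σ_β := hσβ, seg := hseg, Rb := Rb,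
      ρ' := Rb + 1, norm_le := hRb, ρ'_ge := le_rfl, M := frameOf he he2 hs, M_zero := frameOf_zero he he2 hs,
      M_one := frameOf_one he he2 hs, norm_M := norm_frameOf he he2 hs, a := a, l := l, δ := δ',
      a_pos := ha0, l_pos := hlpos, δ_pos := hδ'pos, δ_le := hδ'le, l_le := hl_a, δ_room := hδ'room,
      δ_up := hδ'up, δ_clean := hδ'clean }
  have hmdT : ∀ z, md.T z = a • e3 1 + l • frameOf he he2 hs (z - p) := fun z ↦ rfl
  obtain ⟨L, L', hL, hL', hc⟩ := h.exists_isConnectedSum_isConcordant_of_model G md (by linarith) hl_ℓ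
    hl_η (by linarith [ha.2]) F₁ F₂ (fun z hz ↦ by rw [hmdT]; exact hF₁ z hz) hR₁
    (fun z hz ↦ by rw [hmdT]; exact hF₂ z hz) hR₂ (fun z hz ↦ by rw [hmdT]; exact (hTW z hz).2)
  -- back to `K₂`
  refine ⟨L, L', ?_, ?_, hc⟩
  · obtain ⟨A', B', hA', hB', rest⟩ := hL
    exact ⟨A', B', hA', SphereEmbedding.IsIsotopic.trans_holds hK₂Kn hB', rest⟩
  · obtain ⟨A', B', hA', hB', rest⟩ := hL'
    exact ⟨A', B', hA', SphereEmbedding.IsIsotopic.trans_holds hK₂Kn hB', rest⟩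

end Knot.IsConicalConcordance

namespace Knot

/-- **Connected sum of a concordance with a fixed knot (first factor)** — discharge of the named
fact `Knot.exists_isConnectedSum_isConcordant_left` of `BandSumConcordanceCore.lean`: if
`K₁ ~ K₁'` are concordant then for every knot `K₂` some connected sum `K₁ # K₂` is concordant to
some connected sum `K₁' # K₂`. Straighten the concordance to a conical one
(`IsConcordance.exists_conical`), take a good tube along an arc
(`IsConicalConcordance.exists_goodTube`) and carry a small copy of `K₂` along it
(`IsConicalConcordance.exists_isConnectedSum_isConcordant`). Fox–Milnor (1966), §1: "the
cobordism class of `k₁ # k₂` depends only on the classes of `k₁` and `k₂`"; Livingston (2005),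
Thm. 2.2. [cite: FoxMilnor1966, §1] -/
theorem exists_isConnectedSum_isConcordant_left_holds : exists_isConnectedSum_isConcordant_left := by
  intro K₁ K₁' K₂ hc
  obtain ⟨f₀, hf₀⟩ := hc
  obtain ⟨f, hf, δ, hδ, hδ4, hc₁, hc₂⟩ := hf₀.exists_conical
  have h : IsConicalConcordance K₁ K₁' f δ := ⟨hf, hδ, hδ4, hc₁, hc₂⟩
  obtain ⟨w, η, ε, G⟩ := h.exists_goodTube 0
  exact h.exists_isConnectedSum_isConcordant G K₂

/-- **Connected sum of a fixed knot with a concordance (second factor)**, proved (from the first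
factor and commutativity `IsConnectedSum.comm_holds`). [cite: FoxMilnor1966, §1] -/
theorem exists_isConnectedSum_isConcordant_right_holds : exists_isConnectedSum_isConcordant_right :=
  exists_isConnectedSum_isConcordant_right_of_left exists_isConnectedSum_isConcordant_left_holds
    IsConnectedSum.comm_holds

/-- **The connected sum of concordances** (`exists_isConnectedSum_isConcordant`,
`BandSumConcordance.lean`), granted Schubert's uniqueness of the connected sum
(`IsConnectedSum.isIsotopic`). [cite: FoxMilnor1966, §1] -/
theorem exists_isConnectedSum_isConcordant_of_schubert (huniq : IsConnectedSum.isIsotopic) :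
    exists_isConnectedSum_isConcordant :=
  exists_isConnectedSum_isConcordant_of_left exists_isConnectedSum_isConcordant_left_holds
    IsConnectedSum.comm_holds huniq

/-- **Concordance is a congruence for the connected sum, granted Schubert's theorem.** The named
fact `Knot.IsConnectedSum.isConcordant` (`BandSum.lean`: if `K₁ ~ K₁'`, `K₂ ~ K₂'` and
`K = K₁ # K₂`, `K' = K₁' # K₂'` for *arbitrary* witnesses then `K ~ K'`) follows from the proved
one-sided carrying construction (`exists_isConnectedSum_isConcordant_left_holds`), commutativity
(`IsConnectedSum.comm_holds`), "isotopic knots are concordant" and transitivity of concordance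
(theorems of the tree), and the single remaining hypothesis: uniqueness of the connected sum up
to isotopy (`IsConnectedSum.isIsotopic`, Schubert (1949); the quantification over arbitrary
witnesses on both sides makes this hypothesis necessary as well). Fox–Milnor (1966), §1;
Livingston (2005), Thm. 2.2. [cite: FoxMilnor1966, §1] -/
theorem IsConnectedSum.isConcordant_of_schubert (huniq : IsConnectedSum.isIsotopic) :
    IsConnectedSum.isConcordant :=
  IsConnectedSum.isConcordant_of_left exists_isConnectedSum_isConcordant_left_holds
    IsConnectedSum.comm_holds huniq

end Knot

end Literature.Topology.FourManifolds
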